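import Summits.AnomalousDissipation.AnomalousDissipation.Theorems.SolenoidalFractalHomogenisationLagrangianStepLadderHypocoerciveSkew
import HarnessLib

/-!
# K1L_D `stub_D1_V0thg` (stmt-AnomalousDissipation-27980), R3′ lane «SidebandTailCrushing» (tenure D28-16 (3)) — file F1b:
# the three-term hypocoercivity lemma with a MEAN-VALUE START (no control of `‖K y(t₀)‖` needed)

Helper file of route `SolenoidalFractalHomogenisation` (prover seat `ad-k1l-cellLawV-w1` g10; plan memo
`Cruxes/LagrangianRenormalisationStepDesign/Lines/onelevel-vtheta-R3-plan.md` §4 «START-UP»; `--supports stmt-AnomalousDissipation-27980 --as helper`).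

`LadderCrush.hypocoercive_decay'` (file F1c: time-dependent skew part `B t`, `[K,B t] = G(t)•C`) bounds `‖y t₁‖²` by
`3e^{−λ(t₁−t₀)}(‖y t₀‖² + α‖K(y t₀)‖²)`.  On the half-height window of a hopping slot the
state at the window start is already spread along the ladder and `‖K y(t₀)‖` is not controlled by `‖y(t₀)‖`.  This file removes it at the price of a
start-up delay `δ₁`: the energy identity `d‖y‖²/dt = −2⟪D y, y⟫ ≤ 0` and the Lagrange mean-value theorem on `[t₀, t₀+δ₁]` give a time `c` with
`⟪D y(c), y(c)⟫ ≤ ‖y t₀‖²/(2δ₁)`, hence `‖K y(c)‖² ≤ ‖y t₀‖²/(2δ₁ lo₁)` by (h1), and F1c on `[c, t₁]` yields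
**`‖y t₁‖² ≤ 3(1 + α/(2δ₁lo₁))·e^{−λ(t₁−t₀−δ₁)}·‖y t₀‖²`** (`hypocoercive_decay_started'`).  No integrals (only `exists_hasDerivAt_eq_slope`), no
definition, no sorry.  NOT a proof of `stub_D1_V0thg`, of K1L_D or of AD; rung F-D1.A0 infrastructure.
-/

set_option linter.dupNamespace false -- single-conjunct summit: `Summit.AnomalousDissipation.AnomalousDissipation.…` is the mandated namespace

namespace Summit.AnomalousDissipation.AnomalousDissipation.Theorems.SolenoidalFractalHomogenisation.LagrangianStep.LadderCrush

open Set
open scoped InnerProductSpace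

noncomputable section

variable {F : Type*} [NormedAddCommGroup F] [InnerProductSpace ℝ F]

/-- **Energy identity**: along `y′ = B(t)y − D(t)y` with `B(t)` skew, `d‖y‖²/dt = −2⟪D(t) y, y⟫`.
[cite: Villani2009, Part I §2 (A*A + B: dissipation of the norm)] -/
theorem hasDerivAt_norm_sq (B D : ℝ → (F →L[ℝ] F)) (y : ℝ → F)
    (hB : ∀ t u v, ⟪B t u, v⟫_ℝ = -⟪u, B t v⟫_ℝ) {t : ℝ} (hy : HasDerivAt y (B t (y t) - D t (y t)) t) :
    HasDerivAt (fun s => ‖y s‖ ^ 2) (-(2 * ⟪D t (y t), y t⟫_ℝ)) t := by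
  have h := hy.norm_sq
  have e : 2 * ⟪y t, B t (y t) - D t (y t)⟫_ℝ = -(2 * ⟪D t (y t), y t⟫_ℝ) := by
    rw [inner_sub_right, ← real_inner_comm (y t) (B t (y t)), skew_inner_self (B t) (hB t) (y t),
      zero_sub, real_inner_comm (D t (y t)) (y t)]
    ring
  rw [e] at h
  exact h

/-- **The norm is non-increasing** along `y′ = B(t)y − D(t)y` (`B(t)` skew, `D(t) ≥ 0`). [cite: Villani2009, Part I §2] -/
theorem norm_sq_antitoneOn (B D : ℝ → (F →L[ℝ] F)) (y : ℝ → F) {t₀ t₁ : ℝ}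
    (hB : ∀ t u v, ⟪B t u, v⟫_ℝ = -⟪u, B t v⟫_ℝ) (hDp : ∀ t u, 0 ≤ ⟪D t u, u⟫_ℝ)
    (hy : ∀ t ∈ Icc t₀ t₁, HasDerivAt y (B t (y t) - D t (y t)) t) :
    AntitoneOn (fun s => ‖y s‖ ^ 2) (Icc t₀ t₁) := by
  have hd : ∀ t ∈ Icc t₀ t₁, HasDerivAt (fun s => ‖y s‖ ^ 2) (-(2 * ⟪D t (y t), y t⟫_ℝ)) t :=
    fun t ht => hasDerivAt_norm_sq B D y hB (hy t ht)
  refine antitoneOn_of_deriv_nonpos (convex_Icc t₀ t₁) ?_ ?_ ?_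
  · exact fun t ht => (hd t ht).continuousAt.continuousWithinAt
  · intro t ht
    rw [interior_Icc] at ht
    exact (hd t ⟨ht.1.le, ht.2.le⟩).differentiableAt.differentiableWithinAt
  · intro t ht
    rw [interior_Icc] at ht
    rw [(hd t ⟨ht.1.le, ht.2.le⟩).deriv]
    have := hDp t (y t)
    linarith

/-- **Mean-value start**: on `[t₀, t₀+δ₁] ⊆ [t₀,t₁]` there is a time `c` with `⟪D(c) y(c), y(c)⟫ ≤ ‖y t₀‖²/(2δ₁)` (Lagrange's theorem for `t ↦ ‖y t‖²`,
whose derivative is `−2⟪Dy,y⟫` and whose total drop is at most `‖y t₀‖²`). [cite: Villani2009, Part I §2] -/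
theorem exists_form_le (B D : ℝ → (F →L[ℝ] F)) (y : ℝ → F) {t₀ t₁ δ₁ : ℝ}
    (hδ : 0 < δ₁) (hδt : t₀ + δ₁ ≤ t₁)
    (hB : ∀ t u v, ⟪B t u, v⟫_ℝ = -⟪u, B t v⟫_ℝ)
    (hy : ∀ t ∈ Icc t₀ t₁, HasDerivAt y (B t (y t) - D t (y t)) t) :
    ∃ c ∈ Ioo t₀ (t₀ + δ₁), ⟪D c (y c), y c⟫_ℝ ≤ ‖y t₀‖ ^ 2 / (2 * δ₁) := by
  have hd : ∀ t ∈ Icc t₀ (t₀ + δ₁), HasDerivAt (fun s => ‖y s‖ ^ 2) (-(2 * ⟪D t (y t), y t⟫_ℝ)) t :=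
    fun t ht => hasDerivAt_norm_sq B D y hB (hy t ⟨ht.1, ht.2.trans hδt⟩)
  have hcont : ContinuousOn (fun s => ‖y s‖ ^ 2) (Icc t₀ (t₀ + δ₁)) :=
    fun t ht => (hd t ht).continuousAt.continuousWithinAt
  have hab : t₀ < t₀ + δ₁ := by linarith
  obtain ⟨c, hc, hslope⟩ := exists_hasDerivAt_eq_slope (fun s => ‖y s‖ ^ 2) (fun t => -(2 * ⟪D t (y t), y t⟫_ℝ)) hab hcont
    (fun t ht => hd t ⟨ht.1.le, ht.2.le⟩)
  refine ⟨c, hc, ?_⟩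
  have hδ' : t₀ + δ₁ - t₀ = δ₁ := by ring
  rw [hδ'] at hslope
  -- `-(2⟪Dy,y⟫(c)) = (‖y(t₀+δ₁)‖² − ‖y t₀‖²)/δ₁ ≥ −‖y t₀‖²/δ₁`
  have hnn : 0 ≤ ‖y (t₀ + δ₁)‖ ^ 2 := sq_nonneg _
  have h1 : 2 * ⟪D c (y c), y c⟫_ℝ = (‖y t₀‖ ^ 2 - ‖y (t₀ + δ₁)‖ ^ 2) / δ₁ := by
    have : -(2 * ⟪D c (y c), y c⟫_ℝ) = (‖y (t₀ + δ₁)‖ ^ 2 - ‖y t₀‖ ^ 2) / δ₁ := hslope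
    field_simp
    field_simp at this
    linarith
  have h2 : (‖y t₀‖ ^ 2 - ‖y (t₀ + δ₁)‖ ^ 2) / δ₁ ≤ ‖y t₀‖ ^ 2 / δ₁ :=
    div_le_div_of_nonneg_right (by linarith) hδ.le
  have h3 : ⟪D c (y c), y c⟫_ℝ ≤ ‖y t₀‖ ^ 2 / δ₁ / 2 := by linarith
  rw [div_div, mul_comm] at h3
  exact h3

/-- **THE THREE-TERM HYPOCOERCIVE DECAY LEMMA WITH A MEAN-VALUE START.**  Under the hypotheses of `hypocoercive_decay` on `[t₀,t₁]` and a start-up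
delay `0 < δ₁`, `t₀ + δ₁ ≤ t₁`:  `‖y t₁‖² ≤ 3(1 + α/(2δ₁ lo₁))·exp(−λ(t₁−t₀−δ₁))·‖y t₀‖²`.
[cite: BedrossianCotiZelati2017, §2 (hypocoercivity functional, enhanced dissipation)] [cite: Villani2009, Part I §2 (A*A + B)] -/
theorem hypocoercive_decay_started' (V : Submodule ℝ F) (K C : F →L[ℝ] F) (B D : ℝ → (F →L[ℝ] F)) (G : ℝ → ℝ) (y : ℝ → F)
    {t₀ t₁ δ₁ : ℝ} (hδ : 0 < δ₁) (hδt : t₀ + δ₁ ≤ t₁)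
    (hB : ∀ t u v, ⟪B t u, v⟫_ℝ = -⟪u, B t v⟫_ℝ) (hCs : ∀ u v, ⟪C u, v⟫_ℝ = ⟪u, C v⟫_ℝ)
    (hKB : ∀ t ∈ Icc t₀ t₁, ∀ u, K (B t u) - B t (K u) = G t • C u)
    (hDs : ∀ t u v, ⟪D t u, v⟫_ℝ = ⟪u, D t v⟫_ℝ) (hDp : ∀ t u, 0 ≤ ⟪D t u, u⟫_ℝ) (hKD : ∀ t u, K (D t u) = D t (K u))
    (hVK : ∀ u ∈ V, K u ∈ V)
    (hyV : ∀ t ∈ Icc t₀ t₁, y t ∈ V) (hy : ∀ t ∈ Icc t₀ t₁, HasDerivAt y (B t (y t) - D t (y t)) t)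
    {Gm GM lo₁ CJ A η₀ η₁ U₁ U₂ U₃ α β lam : ℝ} (hG : ∀ t ∈ Icc t₀ t₁, Gm ≤ G t ∧ G t ≤ GM)
    (hGm : 0 ≤ Gm) (hlo₁ : 0 < lo₁) (hCJ : 0 < CJ) (hα : 0 < α) (hβ : 0 < β) (hlam : 0 ≤ lam)
    (h1 : ∀ t ∈ Icc t₀ t₁, ∀ u ∈ V, lo₁ * ‖K u‖ ^ 2 ≤ ⟪D t u, u⟫_ℝ)
    (h2 : ∀ t ∈ Icc t₀ t₁, ∀ u ∈ V, ⟪D t (C u), C u⟫_ℝ ≤ CJ * ⟪D t u, u⟫_ℝ)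
    (h3 : ∀ u ∈ V, ‖C u‖ ^ 2 ≤ A * ‖u‖ ^ 2)
    (h4 : ∀ t ∈ Icc t₀ t₁, ∀ u ∈ V, -(η₀ * ⟪D t u, u⟫_ℝ + η₁ * ⟪D t (K u), K u⟫_ℝ) ≤ ⟪K u, C (B t u) - B t (C u)⟫_ℝ)
    (h5 : ∀ t ∈ Icc t₀ t₁, ∀ u ∈ V, ‖u‖ ^ 2 ≤ U₁ * ‖C u‖ ^ 2 + U₂ * ‖K u‖ ^ 2 + U₃ * ⟪D t u, u⟫_ℝ)
    (P1 : 4 * A * β ^ 2 ≤ α) (P2 : 8 * CJ * β ^ 2 ≤ α) (P3 : 2 * α ^ 2 * GM ^ 2 ≤ β * Gm * lo₁) (P4 : 8 * β * η₀ ≤ 1)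
    (P4b : 4 * β * η₁ ≤ α)
    (P5 : 6 * lam * α ≤ lo₁) (P6 : 6 * lam * U₂ ≤ lo₁) (P7 : 6 * lam * U₃ ≤ 1) (P8 : 3 * lam * U₁ ≤ 2 * β * Gm) :
    ‖y t₁‖ ^ 2 ≤ 3 * (1 + α / (2 * δ₁ * lo₁)) * Real.exp (-(lam * (t₁ - t₀ - δ₁))) * ‖y t₀‖ ^ 2 := by
  obtain ⟨c, hc, hform⟩ := exists_form_le B D y hδ hδt hB hy
  have hc0 : t₀ ≤ c := hc.1.le
  have hc1 : c ≤ t₁ := hc.2.le.trans hδt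
  have hsub : Icc c t₁ ⊆ Icc t₀ t₁ := Icc_subset_Icc hc0 le_rfl
  -- F1c on `[c, t₁]`
  have hmain := hypocoercive_decay' V K C B D G y hc1 hB hCs (fun t ht => hKB t (hsub ht)) hDs hDp hKD hVK
    (fun t ht => hyV t (hsub ht))
    (fun t ht => hy t (hsub ht)) (fun t ht => hG t (hsub ht)) hGm hlo₁ hCJ hα hβ hlam (fun t ht => h1 t (hsub ht))
    (fun t ht => h2 t (hsub ht)) h3 (fun t ht => h4 t (hsub ht)) (fun t ht => h5 t (hsub ht)) P1 P2 P3 P4 P4b P5 P6 P7 P8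
  -- the two quantities at time `c`
  have hcI : c ∈ Icc t₀ t₁ := ⟨hc0, hc1⟩
  have hKc : α * ‖K (y c)‖ ^ 2 ≤ α / (2 * δ₁ * lo₁) * ‖y t₀‖ ^ 2 := by
    have h := (h1 c hcI (y c) (hyV c hcI)).trans hform
    -- lo₁‖K y c‖² ≤ ‖y t₀‖²/(2δ₁)
    have h' : ‖K (y c)‖ ^ 2 ≤ ‖y t₀‖ ^ 2 / (2 * δ₁ * lo₁) := by
      rw [le_div_iff₀ (by positivity)]
      have := mul_le_mul_of_nonneg_right h (by positivity : (0:ℝ) ≤ 2 * δ₁)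
      have e : ‖y t₀‖ ^ 2 / (2 * δ₁) * (2 * δ₁) = ‖y t₀‖ ^ 2 := by field_simp
      rw [e] at this
      nlinarith
    have h'' := mul_le_mul_of_nonneg_left h' hα.le
    have e : α * (‖y t₀‖ ^ 2 / (2 * δ₁ * lo₁)) = α / (2 * δ₁ * lo₁) * ‖y t₀‖ ^ 2 := by ring
    rw [e] at h''
    exact h''
  have hyc : ‖y c‖ ^ 2 ≤ ‖y t₀‖ ^ 2 :=
    norm_sq_antitoneOn B D y hB hDp hy (left_mem_Icc.2 (hc0.trans hc1)) hcI hc0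
  -- the exponential factor
  have hexp : Real.exp (-(lam * (t₁ - c))) ≤ Real.exp (-(lam * (t₁ - t₀ - δ₁))) := by
    apply Real.exp_le_exp.2
    have : t₁ - t₀ - δ₁ ≤ t₁ - c := by linarith [hc.2]
    nlinarith
  have hE : 0 ≤ Real.exp (-(lam * (t₁ - c))) := (Real.exp_pos _).le
  have hsum : ‖y c‖ ^ 2 + α * ‖K (y c)‖ ^ 2 ≤ (1 + α / (2 * δ₁ * lo₁)) * ‖y t₀‖ ^ 2 := by nlinarith
  have hpos : 0 ≤ (1 + α / (2 * δ₁ * lo₁)) * ‖y t₀‖ ^ 2 := by positivity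
  calc ‖y t₁‖ ^ 2 ≤ 3 * Real.exp (-(lam * (t₁ - c))) * (‖y c‖ ^ 2 + α * ‖K (y c)‖ ^ 2) := hmain
    _ ≤ 3 * Real.exp (-(lam * (t₁ - c))) * ((1 + α / (2 * δ₁ * lo₁)) * ‖y t₀‖ ^ 2) :=
        mul_le_mul_of_nonneg_left hsum (by positivity)
    _ ≤ 3 * Real.exp (-(lam * (t₁ - t₀ - δ₁))) * ((1 + α / (2 * δ₁ * lo₁)) * ‖y t₀‖ ^ 2) :=
        mul_le_mul_of_nonneg_right (mul_le_mul_of_nonneg_left hexp (by norm_num)) hpos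
    _ = 3 * (1 + α / (2 * δ₁ * lo₁)) * Real.exp (-(lam * (t₁ - t₀ - δ₁))) * ‖y t₀‖ ^ 2 := by ring

end

end Summit.AnomalousDissipation.AnomalousDissipation.Theorems.SolenoidalFractalHomogenisation.LagrangianStep.LadderCrush
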